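import Literature.NumberTheory.ComplexMultiplication.MainTheoremCMLevelPairOfModel
import Literature.AlgebraicGeometry.Motives.AbelianVarietyGoodReductionConjugateGeomTorsion
import Literature.NumberTheory.ComplexMultiplication.MainTheoremOfComplexMultiplication
import HarnessLib

/-!
# Main theorem of complex multiplication — the relative polarisation clause from the level-`N` REDUCTION DATA
# (the `§15 PAIR` slot of the S7a assembly, in the spine's own currency)

[Shimura1998] G. Shimura, *Abelian Varieties with Complex Multiplication and Modular Functions*, Princeton 1998,
§18.6, proof of Thm. 18.6, pp. 128–130 (step 11 «`t^σ = κt`», «`E_ℓ(κ⁻¹(X^σ)) = E_ℓ(pX)`»), p. 169 («put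
`ξ′ = ξ* ∘ Φ(g(d))` … `X^σ` corresponds to `(g(d)g(d)^ρ)⁻¹pζ` with respect to `ξ′`»).

Topic: cell `hodgecm-mathlib` (D-0151), row II-1 S7a `levelStructure`, B-p15's assembly `S7aHarness.core` §15.  The
theorem `weilPairingLevel_conjugate_reindex_eq_pow_of_levelData` is
`MainTheoremCMLevelPairOfModel.weilPairingLevel_conjugate_reindex_eq_pow_of_model` with its three «derived» inputs
produced inside from the RAW data the spine holds at the chosen Frobenius place `v` and the prime `ℓ`:
* S5's Galois hypothesis «`κ = σ̃`-conjugation on `A₁[ℓᵏ](L̄₁)`» from the GEOMETRIC TORSION CLAUSE (2′) of the joint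
  specialisation fact (F-S5c) + the Tate compatibility of the pair datum `Hγ` + `κ̃ = F`
  (`GoodReductionAt.HomReduction.map_conjugateBaseChangeAlongIso_baseChange_eq_conjPoints`, gauge `e := Iso.refl`);
* the reindex scalar `β = g⁻¹` and the lattice identity `𝔠 = β · t𝔞` from the TT-idèle's clause-3 form
  `t𝔞 = (g·1⁻¹)𝔠` and `ξ′(w) = ξ₂((g·1⁻¹)⁻¹w)` (the literal outputs of
  `MainTheoremCMLevelTorsionTransport.exists_reindex_forall_conj_eq_of_torsionCongruence_units` with `b := 1`);
* «`κ ∘ ξ₁ = ξ₂` read through `E`» from `ξ* = κ_ℂ ∘ ξ₁` and `ξ₂ = E ∘ ξ*` (§13).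
One theorem; no definition, no instance, no named fact.  HC_CM is proved only modulo the printed citations until
rung 0 closes.
-/

noncomputable section

open CategoryTheory CategoryTheory.Limits AlgebraicGeometry NumberField IsDedekindDomain
open scoped NumberField nonZeroDivisors
open Literature.AlgebraicGeometry.Motives Literature.AlgebraicGeometry.Motives.AbelianVariety
open Literature.AlgebraicGeometry.Motives.AbelianVariety.GoodReductionAt
open Literature.NumberTheory.NumberFields

namespace Literature.NumberTheory.ComplexMultiplication

open FractionalIdeal (spanSingleton)

/-- **§15 PAIR of the S7a assembly, from the level-`N` reduction data** ([Shimura1998] p. 130 step 11 + «`X^σ`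
corresponds to `pζ` with respect to `ξ*`» + p. 169 reindex).  Inputs, in the currency of B-p15's `S7aHarness.core`
spine at its §15: the junction data (`A₀ ι₀ X πA hπA ξ`, `σ ∈ Aut ℂ`, `πσ hπσ`, `ℓ`, the two `[ℓᵏ]`-dominances);
the level field `L₁ ⊇ L` with `γ ∈ Aut(L₁/F₀)`, `σ|_{L₁} = γ`; the Frobenius place `v`, `q = pⁿ = N(v ∩ F₀)`, the
good-reduction datum `R` of the model `A₁ = A₀ ⊗_L L₁`, the pair datum `Hγ` towards the canonical `conjFrob`, the
homomorphism `κ : A₁ → A₁^γ` with `κ̃ = F` (G10) and its three dominances (isogeny), `v ∤ ℓ`; at `ℓ`, the Tate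
specialisations `T0`, `Tγ`, the compatibility `h0γ`, the Frobenius lift `σ̃` with (σ-a), (σ-b) and the geometric
torsion clause (2′) for every `ℓᵐ` (F-S5c); the model uniformisations `ξ₁ = T⁻¹ ∘ ξ`, `ξ* = κ_ℂ ∘ ξ₁`,
`ξ₂ = E ∘ ξ*` (§8, §13); the TT-idèle `t`, the reflex norm `g = g(d₀)` with `g⁻¹ ≠ 0`, the lattice `𝔠` of `ξ*` with
`t𝔞 = (g·1⁻¹)𝔠`, and the reindexed `ξ′` of type `t𝔞` with `ξ′(w) = ξ₂((g·1⁻¹)⁻¹ w)` (G11a with `b := 1`); the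
exponent `q` with `q = pⁿ`.  Conclusion: the relative polarisation clause of `IsLevelUniformization` (its last
conjunct) for `𝔟 := ideleMulIdealUnits t 𝔞`, `β := g⁻¹`, exponent `q` — verbatim.
[cite: Shimura1998, §18.6 proof of Thm. 18.6, pp. 128–130, 165, 168–169] [cite: MumfordAV1970, §20 (property (3) of e_n, p. 186)] -/
theorem weilPairingLevel_conjugate_reindex_eq_pow_of_levelData
    {K : Type} [Field K] [NumberField K] {Φ : CMType K} (𝔞 : (FractionalIdeal (𝓞 K)⁰ K)ˣ)
    {F₀ L L₁ : Type} [Field F₀] [Field L] [Field L₁] [NumberField L₁] [Algebra F₀ L₁] [Algebra L L₁]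
    [Algebra L₁ ℂ] [Algebra L ℂ] [IsScalarTower L L₁ ℂ]
    (A₀ : AbelianVariety L) (ι₀ : 𝓞 K →+* End A₀)
    -- the junction's data
    (X : CartierDivisor A₀.X.left)
    (πA : (A₀.baseChange ℂ).X.left ⟶ A₀.X.left) (hπA : πA = pullback.fst A₀.X.hom (bcSpec L ℂ)) [IsDominant πA]
    (ξ : CMTypeUniformization Φ 𝔞 (A₀.baseChange ℂ) ((endBaseChange ℂ A₀).comp ι₀))
    (σ : ℂ ≃+* ℂ)
    (πσ : ((A₀.baseChange ℂ).conjugate σ).X.left ⟶ (A₀.baseChange ℂ).X.left)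
    (hπσ : πσ = baseChangeHomFst σ.toRingHom (A₀.baseChange ℂ).X) [IsDominant πσ]
    (ℓ : ℕ) [Fact ℓ.Prime]
    [∀ k : ℕ, IsDominant (Hom.toSchemeHom (((ℓ ^ k : ℕ) : ℤ) • 𝟙 (A₀.baseChange ℂ)))]
    [∀ k : ℕ, IsDominant (Hom.toSchemeHom (((ℓ ^ k : ℕ) : ℤ) • 𝟙 ((A₀.baseChange ℂ).conjugate σ)))]
    -- the level field and the Frobenius place
    (γ : L₁ ≃ₐ[F₀] L₁) (hσ : ∀ x : L₁, σ (algebraMap L₁ ℂ x) = algebraMap L₁ ℂ (γ.toRingEquiv x))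
    (v : HeightOneSpectrum (𝓞 L₁)) (hγ : IsArithFrobAt (𝓞 F₀) γ v.asIdeal) (R : (A₀.baseChange L₁).GoodReductionAt v)
    (p n : ℕ) [ExpChar v.asIdeal.ResidueField p] (hq : Nat.card (𝓞 F₀ ⧸ v.asIdeal.under (𝓞 F₀)) = p ^ n)
    (Hγ : HomReduction R (R.conjFrob γ hγ p n hq))
    (κ : A₀.baseChange L₁ ⟶ (A₀.baseChange L₁).conjugate γ.toRingEquiv)
    (hκ : Hγ.redHom κ = R.reduction.relFrobenius p n)
    [IsDominant (Hom.toSchemeHom κ)] [IsDominant (Hom.toSchemeHom (Hom.baseChange ℂ κ))]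
    [IsDominant (Hom.toSchemeHom (Hom.baseChange (AlgebraicClosure L₁) κ))]
    (hℓv : ((ℓ : ℕ) : 𝓞 L₁) ∉ v.asIdeal)
    -- F-S5c at `ℓ`: Tate specialisations, compatibility of `Hγ`, the Frobenius lift `σ̃` and the clause (2′)
    (T0 : R.TateSpecialisation ℓ) (Tγ : (R.conjFrob γ hγ p n hq).TateSpecialisation ℓ)
    (h0γ : Hγ.IsTateCompatible T0 Tγ)
    (σ' : AlgebraicClosure L₁ ≃+* AlgebraicClosure L₁)
    (hσ'a : ∀ x : L₁, σ' (algebraMap L₁ (AlgebraicClosure L₁) x) =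
      algebraMap L₁ (AlgebraicClosure L₁) (γ.toRingEquiv x))
    (hσ'b : ∀ (m : ℕ) (ζ : AlgebraicClosure L₁), ζ ^ (ℓ ^ m) = 1 → σ' ζ = ζ ^ (p ^ n))
    (h2' : ∀ (m : ℕ) (x : (A₀.baseChange L₁).geomTorsion (ℓ ^ m : ℕ))
        (x' : ((A₀.baseChange L₁).conjugate γ.toRingEquiv).geomTorsion (ℓ ^ m : ℕ)),
      Additive.toMul (x' : ((A₀.baseChange L₁).conjugate γ.toRingEquiv).geomPoints) =
        (((A₀.baseChange L₁).conjugate γ.toRingEquiv).pointsMulEquiv (AlgebraicClosure L₁)).symm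
          (AlgPoints.map (conjugateBaseChangeAlongIso γ.toRingEquiv σ' hσ'a (A₀.baseChange L₁)).inv.hom.hom.hom
            (((A₀.baseChange L₁).baseChange (AlgebraicClosure L₁)).conjPoints σ'
              ((A₀.baseChange L₁).pointsMulEquiv (AlgebraicClosure L₁)
                (Additive.toMul (x : (A₀.baseChange L₁).geomPoints))))) →
      (Tγ.reductionTorsionEquiv hℓv m x' : (R.conjFrob γ hγ p n hq).reduction.geomPoints) =
        Hom.geomPointsMap (R.reduction.relFrobenius p n)
          (T0.reductionTorsionEquiv hℓv m x : R.reduction.geomPoints))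
    -- §8, §13: `ξ₁ = T⁻¹ ∘ ξ`, `ξ* = κ_ℂ ∘ ξ₁`, `ξ₂ = E ∘ ξ*`
    (ξ₁ : CMTypeUniformization Φ 𝔞 ((A₀.baseChange L₁).baseChange ℂ)
      ((endBaseChange ℂ (A₀.baseChange L₁)).comp ((endBaseChange L₁ A₀).comp ι₀)))
    (hT : ∀ x : K, ξ.r x = AlgPoints.map (baseChangeTowerIso L L₁ ℂ A₀).hom.hom.hom.hom (ξ₁.r x))
    {𝔠 : (FractionalIdeal (𝓞 K)⁰ K)ˣ}
    (ξs : CMTypeUniformization Φ 𝔠 (((A₀.baseChange L₁).conjugate γ.toRingEquiv).baseChange ℂ)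
      ((endBaseChange ℂ ((A₀.baseChange L₁).conjugate γ.toRingEquiv)).comp
        (((A₀.baseChange L₁).endConjugate γ.toRingEquiv).comp ((endBaseChange L₁ A₀).comp ι₀))))
    (hξs : ∀ u : K, ξs.r u = AlgPoints.map (Hom.baseChange ℂ κ).hom.hom.hom (ξ₁.r u))
    (ξ₂ : CMTypeUniformization Φ 𝔠 ((A₀.baseChange ℂ).conjugate σ)
      (((A₀.baseChange ℂ).endConjugate σ).comp ((endBaseChange ℂ A₀).comp ι₀)))
    (hξ₂ : ∀ u : K, ξ₂.r u =
      AlgPoints.map ((conjugateBaseChangeAlongIso γ.toRingEquiv σ hσ (A₀.baseChange L₁)).hom ≫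
        Hom.conjugate σ (baseChangeTowerIso L L₁ ℂ A₀).hom).hom.hom.hom (ξs.r u))
    -- the TT-idèle `t`, `g = g(d₀)`, the lattice identity (clause 3 form) and the reindexed `ξ′` (G11a, `b := 1`)
    (t : (FiniteAdeleRing (𝓞 K) K)ˣ) (g : K) (hβ : g⁻¹ ≠ 0)
    (h𝔠 : IdeleAction.ideleMulIdeal t (𝔞 : FractionalIdeal (𝓞 K)⁰ K) =
      spanSingleton (𝓞 K)⁰ (g * (1 : K)⁻¹) * (𝔠 : FractionalIdeal (𝓞 K)⁰ K))
    (ξ' : CMTypeUniformization Φ (ideleMulIdealUnits t 𝔞) ((A₀.baseChange ℂ).conjugate σ)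
      (((A₀.baseChange ℂ).endConjugate σ).comp ((endBaseChange ℂ A₀).comp ι₀)))
    (hξ' : ∀ w : K, ξ'.r w = ξ₂.r ((g * (1 : K)⁻¹)⁻¹ * w))
    -- the exponent
    (q : ℕ) (hpq : q = p ^ n) :
    ∀ (k : ℕ) (u w x y : K)
      (hu : ((ℓ ^ k : ℕ) : K) * u ∈ ((ideleMulIdealUnits t 𝔞 : (FractionalIdeal (𝓞 K)⁰ K)ˣ) : FractionalIdeal (𝓞 K)⁰ K))
      (hw : ((ℓ ^ k : ℕ) : K) * w ∈ ((ideleMulIdealUnits t 𝔞 : (FractionalIdeal (𝓞 K)⁰ K)ˣ) : FractionalIdeal (𝓞 K)⁰ K))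
      (hx : ((ℓ ^ k : ℕ) : K) * x ∈ (𝔞 : FractionalIdeal (𝓞 K)⁰ K))
      (hy : ((ℓ ^ k : ℕ) : K) * y ∈ (𝔞 : FractionalIdeal (𝓞 K)⁰ K)),
      x - g⁻¹ * u ∈ FractionalIdeal.spanSingleton (𝓞 K)⁰ g⁻¹ *
          ((ideleMulIdealUnits t 𝔞 : (FractionalIdeal (𝓞 K)⁰ K)ˣ) : FractionalIdeal (𝓞 K)⁰ K) →
      y - g⁻¹ * w ∈ FractionalIdeal.spanSingleton (𝓞 K)⁰ g⁻¹ *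
          ((ideleMulIdealUnits t 𝔞 : (FractionalIdeal (𝓞 K)⁰ K)ˣ) : FractionalIdeal (𝓞 K)⁰ K) →
      ((A₀.baseChange ℂ).conjugate σ).weilPairingLevel ((X.pullback πA).pullback πσ)
          ⟨ξ'.r u, ξ'.r_nsmul_mem _ u hu⟩ ⟨ξ'.r w, ξ'.r_nsmul_mem _ w hw⟩ =
        ((A₀.baseChange ℂ).weilPairingLevel (X.pullback πA)
          ⟨ξ.r x, ξ.r_nsmul_mem _ x hx⟩ ⟨ξ.r y, ξ.r_nsmul_mem _ y hy⟩) ^ q := by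
  have hg : g ≠ 0 := fun h => hβ (by rw [h, inv_zero])
  have hg1 : g * (1 : K)⁻¹ = g := by rw [inv_one, mul_one]
  -- the lattice identity `𝔠 = g⁻¹ · t𝔞` and the reindex `ξ′(w) = ξ₂(g⁻¹ w)`
  have h𝔠' : (𝔠 : FractionalIdeal (𝓞 K)⁰ K) = spanSingleton (𝓞 K)⁰ g⁻¹ *
      ((ideleMulIdealUnits t 𝔞 : (FractionalIdeal (𝓞 K)⁰ K)ˣ) : FractionalIdeal (𝓞 K)⁰ K) := by
    rw [coe_ideleMulIdealUnits, h𝔠, hg1, ← mul_assoc, FractionalIdeal.spanSingleton_mul_spanSingleton,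
      inv_mul_cancel₀ hg, FractionalIdeal.spanSingleton_one, one_mul]
  have hξ'' : ∀ w : K, ξ'.r w = ξ₂.r (g⁻¹ * w) := fun w => by rw [hξ' w, hg1]
  -- «κ ∘ ξ₁ = ξ₂» read through `E`
  have hξ₂' : ∀ u : K, ξ₂.r u =
      AlgPoints.map ((conjugateBaseChangeAlongIso γ.toRingEquiv σ hσ (A₀.baseChange L₁)).hom ≫
        Hom.conjugate σ (baseChangeTowerIso L L₁ ℂ A₀).hom).hom.hom.hom
        (AlgPoints.map (Hom.baseChange ℂ κ).hom.hom.hom (ξ₁.r u)) := fun u => by rw [hξ₂ u, hξs u]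
  -- step 11: (2′) + Tate compatibility + `κ̃ = F` ⇒ `κ = σ̃` on `A₁[ℓᵐ](L̄₁)` (gauge `e := Iso.refl`)
  have hκσ' : ∀ (m : ℕ) (y : ((A₀.baseChange L₁).baseChange (AlgebraicClosure L₁)).torsionPoints
      (AlgebraicClosure L₁) (ℓ ^ m : ℕ)),
      AlgPoints.map (conjugateBaseChangeAlongIso γ.toRingEquiv σ' hσ'a (A₀.baseChange L₁)).hom.hom.hom.hom
          (AlgPoints.map (Hom.baseChange (AlgebraicClosure L₁) κ).hom.hom.hom y.1) =
        ((A₀.baseChange L₁).baseChange (AlgebraicClosure L₁)).conjPoints σ' y.1 := fun m y =>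
    GoodReductionAt.HomReduction.map_conjugateBaseChangeAlongIso_baseChange_eq_conjPoints γ.toRingEquiv
      (Iso.refl _) h0γ hℓv σ' hσ'a m
      (fun x x' hx' => by
        -- `e := Iso.refl`: `geomPointsMap e⁻¹` is the identity
        convert h2' m x x' hx' using 1
        apply Additive.toMul.injective
        rw [Hom.geomPointsMap_apply, AlgPoints.map_apply]
        exact Category.comp_id _)
      κ (by rw [Iso.refl_hom]; exact (Category.comp_id _).trans hκ) y
  exact weilPairingLevel_conjugate_reindex_eq_pow_of_model A₀ ι₀ X πA hπA ξ σ πσ hπσ ℓ ξ' γ hσ v hγ R p n hq Hγ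
    κ hκ hℓv σ' hσ'a hσ'b hκσ' ξ₁ hT ξ₂ hξ₂' q hpq.symm g⁻¹ h𝔠' hξ''

end Literature.NumberTheory.ComplexMultiplication

end
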